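import Summits.RiemannHypothesis.RiemannHypothesis.Theorems.ZetaStringSemilocalDictionary
import Summits.RiemannHypothesis.RiemannHypothesis.Theorems.HandoffMarginLaw
import HarnessLib

/-!
# The WEIL ↔ DBR dictionary for EVERY finite set of primes `S`: `Q_S(ψ) = ⟨ψ′, ψ′⟩_{G_S,a}` and `T^S ≻ 0 on (−a,a) ↔ Q_S ≥ 0 on C(a)` (RH-FREE)

LINE 1 — LABEL: RH-FREE identities and glue between two explicit TRUNCATED quadratic forms (Column WEIL's semi-local
Weil form `Q_S` at the places `S ∪ {∞}` and Column DBR's hermitian form of the Kreĭn kernel of the `S`-truncated screw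
function `Ψ_S`); the one `∀`-statement (`riemannHypothesis_iff_forall_semilocalKernel`) is an RH-EQUIVALENCE, labelled so,
and is NOT claimed. bears_on: LADDER-RH B-D → B-P(P1) (cell rh-dbr ENGINE-TARGETS §3.1/§3.4 ET6 «necessity depths
δ(N)», QN1; cross-column note XCOL / XCOL-3, rh-dbr-eng-6 g4; director-rh g6 I 15:05:55Z «then general-S glue
δ(N) ≥ 0 = 0 ≤ wallOffset N»). WHAT THIS IS NOT: progress toward RH; no positivity of any truncated form is asserted
here beyond re-indexing; «δ(N) ≥ 0 for all N» is RH restated.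

**Objects (no new definitions; characterised by hypotheses so that a later `Defs` file can name them by `rfl`).**
For a coefficient sequence `c : ℕ → ℝ`, the generalised prime sum `R_c(v) = Σ_{1 ≤ n ≤ e^{|v|}} c(n)(|v| − log n)`
(hypothesis `hR`); for a finite `S ⊆ ℕ`, the `S`-TRUNCATED SCREW FUNCTION
`Ψ_S(v) = Ψ_∅(v) − Σ_{1 ≤ n ≤ e^{|v|}, primeFactors n ⊆ S} Λ(n) n^{-1/2}(|v| − log n)` (hypothesis `hΨ`, coefficients
`weilSemilocalCoeff S`; `Ψ_∅ = archScrew`; `Ψ_{all primes} = Ψ` on every bounded window) — ENGINE-TARGETS §3.4's `Ψ_P` with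
`P = {prime powers of primes in S}`.

* §1 `R_c`: local finite-sum form, continuity, evenness, `R_c(0) = 0`; the triangle identity summed with coefficients
  (`integral_prod_ramp_mul`, from the tree's per-ramp `Suzuki2023Thm43.integral_prod_posPart_sub_log_mul`) and the RAMP
  IDENTITY `⟨ψ′,ψ′⟩_{K_{R_c},a} = Σ_n c(n)(k(log n) + k(−log n))`, `k = ψ ⋆ ψ̃` (`setIntegral_setIntegral_kreinKernel_ramp_deriv`).
* §2 `Ψ_S`: `weilSemilocalPrimeTerm S (ψ ⋆ ψ̃) = ⟨ψ′,ψ′⟩_{K_{R_S},a}` and **`weilSemilocalQuadratic S ψ = ⟨ψ′,ψ′⟩_{G_S,a}`**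
  (`weilSemilocalQuadratic_eq_semilocalForm`; `G_S = kreinKernel Ψ_S`).
* §3 **`isPosSemidefKernelOn_semilocalKernel_iff : IsPosSemidefKernelOn (kreinKernel Ψ_S) (Ioo (−a) a) ↔ WeilSemilocalPositivityOn S a`**
  (combs ⟸; integrated positivity + Column WEIL's closedness ⟹), the one-sided window form `(0, ℓ) ↔ C(ℓ/2)`,
  `↔ ℓ ≤ 2·weilSemilocalThreshold S`; hence the DBR necessity-depth statement «δ(N) ≥ 0» IS Column WEIL's
  `0 ≤ wallOffset N` (`wallOffset_nonneg_iff_semilocalKernel`), and the `∀`-form is RH (`riemannHypothesis_iff_forall_semilocalKernel`,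
  RH-EQUIVALENT by `HandoffMarginLaw.riemannHypothesis_iff_forall_wallOffset_nonneg`).

References: M. Suzuki, J. Lond. Math. Soc. (2) 108 (2023) = arXiv:2206.03682, (1.1), (1.4)–(1.5), (1.10), Prop. 3.1, §4.3;
A. Connes, Selecta Math. 5 (1999) §VII Thm 4; H. Yoshida, Adv. Stud. Pure Math. 21 (1992) Prop. 6; C. Berg, J. P. R.
Christensen, P. Ressel (1984) Ch. 3 §1, Ch. 4 §1.
-/

-- `Summit.RiemannHypothesis.RiemannHypothesis.…` duplicates `RiemannHypothesis` BY DESIGN (D-0017).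
set_option linter.dupNamespace false

noncomputable section

open MeasureTheory Set Filter Complex
open scoped ComplexConjugate BigOperators

namespace Summit.RiemannHypothesis.RiemannHypothesis.Theorems.ZetaStringArchWall

open Literature.NumberTheory.LFunctions Literature.Analysis.Complex
open Summit.RiemannHypothesis.RiemannHypothesis.Theorems.KreinFormComb
open Summit.RiemannHypothesis.RiemannHypothesis.Theorems.MotivicDoor.SemilocalThreshold
open Summit.RiemannHypothesis.RiemannHypothesis.Theorems.MotivicDoor.Semilocal
  (weilSemilocalPositivityOn_of_forall_lt)
open Summit.RiemannHypothesis.RiemannHypothesis.Theorems.MotivicDoor.SemilocalMarkov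
  (weilSemilocalPrimeTerm_empty)
open Summit.RiemannHypothesis.RiemannHypothesis.Theorems.HandoffMarginLaw (wallOffset wallOffset_nonneg_iff
  riemannHypothesis_iff_forall_wallOffset_nonneg)

variable {a : ℝ} {f : ℝ → ℂ} {c : ℕ → ℝ} {R : ℝ → ℝ}

/-! ## §1 Generalised prime sums `R_c(v) = Σ_{n ≤ e^{|v|}} c(n)(|v| − log n)` and the ramp identity -/

/-- Local finite-sum form: if `e^{|v|} ≤ M` then `R_c(v) = Σ_{1 ≤ n ≤ M} c(n) max(|v| − log n, 0)`. [folklore] -/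
theorem ramp_eq_sum_max (hR : ∀ v, R v = ∑ n ∈ Finset.Icc 1 ⌊Real.exp |v|⌋₊, c n * (|v| - Real.log n))
    {v : ℝ} {M : ℕ} (hM : Real.exp |v| ≤ M) :
    R v = ∑ n ∈ Finset.Icc 1 M, c n * max (|v| - Real.log n) 0 := by
  have hsub : Finset.Icc 1 ⌊Real.exp |v|⌋₊ ⊆ Finset.Icc 1 M :=
    Finset.Icc_subset_Icc_right ((Nat.floor_mono hM).trans_eq (Nat.floor_natCast M))
  rw [hR]
  calc ∑ n ∈ Finset.Icc 1 ⌊Real.exp |v|⌋₊, c n * (|v| - Real.log n)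
      = ∑ n ∈ Finset.Icc 1 ⌊Real.exp |v|⌋₊, c n * max (|v| - Real.log n) 0 := by
        refine Finset.sum_congr rfl fun n hn => ?_
        rw [Finset.mem_Icc] at hn
        have hn0 : (0 : ℝ) < n := by exact_mod_cast hn.1
        have hle : Real.log n ≤ |v| := by
          rw [Real.log_le_iff_le_exp hn0]
          exact (Nat.le_floor_iff (Real.exp_pos _).le).1 hn.2
        rw [max_eq_left (sub_nonneg.2 hle)]
    _ = ∑ n ∈ Finset.Icc 1 M, c n * max (|v| - Real.log n) 0 := by
        refine Finset.sum_subset hsub fun n hnM hnN => ?_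
        rw [Finset.mem_Icc] at hnM
        have hlt : ⌊Real.exp |v|⌋₊ < n := not_le.1 fun h => hnN (Finset.mem_Icc.2 ⟨hnM.1, h⟩)
        have hn0 : (0 : ℝ) < n := by exact_mod_cast hnM.1
        have hgt : |v| < Real.log n := by
          rw [Real.lt_log_iff_exp_lt hn0]
          exact (Nat.floor_lt (Real.exp_pos _).le).1 hlt
        rw [max_eq_right (sub_nonpos.2 hgt.le), mul_zero]

/-- `R_c` is continuous (locally a finite sum of the continuous `max(|v| − log n, 0)`). [folklore] -/
theorem continuous_ramp (hR : ∀ v, R v = ∑ n ∈ Finset.Icc 1 ⌊Real.exp |v|⌋₊, c n * (|v| - Real.log n)) :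
    Continuous R := by
  refine continuous_iff_continuousAt.2 fun v₀ => ?_
  set M : ℕ := ⌈Real.exp (|v₀| + 1)⌉₊ with hM
  have hcont : Continuous fun v : ℝ => ∑ n ∈ Finset.Icc 1 M, c n * max (|v| - Real.log n) 0 :=
    continuous_finsetSum _ fun n _ =>
      continuous_const.mul ((continuous_abs.sub continuous_const).max continuous_const)
  refine hcont.continuousAt.congr ?_
  have hopen : IsOpen {v : ℝ | |v| < |v₀| + 1} := isOpen_lt continuous_abs continuous_const
  filter_upwards [hopen.mem_nhds (show |v₀| < |v₀| + 1 by linarith)] with v hv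
  refine (ramp_eq_sum_max hR ?_).symm
  exact (Real.exp_le_exp.2 (le_of_lt hv)).trans (Nat.le_ceil _)

/-- `R_c` is even. [folklore] -/
theorem ramp_neg (hR : ∀ v, R v = ∑ n ∈ Finset.Icc 1 ⌊Real.exp |v|⌋₊, c n * (|v| - Real.log n)) (v : ℝ) :
    R (-v) = R v := by
  rw [hR, hR, abs_neg]

/-- `R_c(0) = 0` (only `n = 1` enters, with `log 1 = 0`). [folklore] -/
theorem ramp_zero (hR : ∀ v, R v = ∑ n ∈ Finset.Icc 1 ⌊Real.exp |v|⌋₊, c n * (|v| - Real.log n)) : R 0 = 0 := by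
  rw [hR, abs_zero, Real.exp_zero]
  have h1 : ⌊(1 : ℝ)⌋₊ = 1 := Nat.floor_one
  rw [h1, Finset.Icc_self, Finset.sum_singleton]
  simp

/-- **The triangle identity, summed with coefficients.** For `f` integrable, vanishing off `(−a,a)`, of mean zero,
`ψ = I₀^{(a)} f`, and `e^{2a} ≤ M`:
`∫∫ R_c(t−u) f(u) conj f(t) = Σ_{1 ≤ n ≤ M} c(n)(−2‖ψ‖² + ‖ψ − ψ(· − log n)‖²)`. [cite: Suzuki2023, §4.3 eq. (4.6) and (4.8), arXiv p. 9] -/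
theorem integral_prod_ramp_mul (hR : ∀ v, R v = ∑ n ∈ Finset.Icc 1 ⌊Real.exp |v|⌋₊, c n * (|v| - Real.log n))
    (ha : 0 < a) (hfi : Integrable f) (hf0 : ∀ t ∉ Ioo (-a) a, f t = 0) (hmean : ∫ t, f t = 0) {M : ℕ}
    (hM : Real.exp (2 * a) ≤ M) :
    ∫ p : ℝ × ℝ, ((R (p.1 - p.2) : ℝ) : ℂ) * (f p.2 * conj (f p.1)) ∂(volume.prod volume) =
      ((∑ n ∈ Finset.Icc 1 M, c n *
        (-2 * (∫ x, ‖screwPrimitive a 0 f x‖ ^ 2) +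
          ∫ x, ‖screwPrimitive a 0 f x - screwPrimitive a 0 f (x - Real.log n)‖ ^ 2) : ℝ) : ℂ) := by
  have hpt : ∀ p : ℝ × ℝ, ((R (p.1 - p.2) : ℝ) : ℂ) * (f p.2 * conj (f p.1)) =
      ∑ n ∈ Finset.Icc 1 M, ((c n : ℝ) : ℂ) *
        (((max (|p.1 - p.2| - Real.log n) 0 : ℝ) : ℂ) * (f p.2 * conj (f p.1))) := by
    intro p
    by_cases h1 : p.1 ∈ Ioo (-a) a
    · by_cases h2 : p.2 ∈ Ioo (-a) a
      · have hv : |p.1 - p.2| ≤ 2 * a := abs_le.2 ⟨by linarith [h1.1, h2.2], by linarith [h1.2, h2.1]⟩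
        have hM' : Real.exp |p.1 - p.2| ≤ M := (Real.exp_le_exp.2 hv).trans hM
        rw [ramp_eq_sum_max hR hM']
        push_cast
        rw [Finset.sum_mul]
        refine Finset.sum_congr rfl fun n _ => ?_
        ring
      · simp [hf0 _ h2]
    · simp [hf0 _ h1]
  simp_rw [hpt]
  rw [integral_finsetSum _ fun n _ => ?_]
  · push_cast
    refine Finset.sum_congr rfl fun n hn => ?_
    rw [integral_const_mul,
      Suzuki2023Thm43.integral_prod_posPart_sub_log_mul ha hfi hf0 hmean (Finset.mem_Icc.1 hn).1]
    push_cast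
    ring
  · exact (integrable_ofReal_mul_mul_conj_prod hfi hf0
      (G := fun p : ℝ × ℝ => max (|p.1 - p.2| - Real.log n) 0) (by fun_prop)).const_mul _

/-- **The ramp identity with coefficients.** For `0 < a`, `ψ ∈ C(a)` and `e^{2a} ≤ M`:
`∫_{(−a,a)}∫_{(−a,a)} (R_c(t) + R_c(u) − R_c(t−u)) ψ′(u) conj ψ′(t) du dt = Σ_{1 ≤ n ≤ M} c(n)(k(log n) + k(−log n))`,
`k = ψ ⋆ ψ̃`. [cite: Suzuki2023, §4.3 eq. (4.6) and (4.8), arXiv p. 9] -/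
theorem setIntegral_setIntegral_kreinKernel_ramp_deriv
    (hR : ∀ v, R v = ∑ n ∈ Finset.Icc 1 ⌊Real.exp |v|⌋₊, c n * (|v| - Real.log n))
    (ha : 0 < a) {ψ : ℝ → ℂ} (hψ : ψ ∈ screwTestC a) {M : ℕ} (hM : Real.exp (2 * a) ≤ M) :
    ∫ t in Ioo (-a) a, ∫ u in Ioo (-a) a, kreinKernel R t u * deriv ψ u * conj (deriv ψ t) =
      ∑ n ∈ Finset.Icc 1 M, ((c n : ℝ) : ℂ) *
        (weilConv ψ (weilReflect ψ) (Real.log n) + weilConv ψ (weilReflect ψ) (-Real.log n)) := by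
  have hφ : deriv ψ ∈ screwTestC0 a := deriv_mem_screwTestC0 hψ
  have hfi : Integrable (deriv ψ) := hφ.1.1.continuous.integrable_of_hasCompactSupport hφ.1.2
  have hf0 : ∀ t ∉ Ioo (-a) a, deriv ψ t = 0 := fun t ht => deriv_apply_eq_zero_of_not_mem hψ ht
  have hmean : ∫ t, deriv ψ t = 0 := hφ.2.2
  rw [setIntegral_setIntegral_kreinKernel_eq_neg_integral_prod (continuous_ramp hR) hfi hf0 hmean,
    integral_prod_ramp_mul hR ha hfi hf0 hmean hM, screwPrimitive_deriv_of_mem hψ]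
  push_cast
  rw [← Finset.sum_neg_distrib]
  refine Finset.sum_congr rfl fun n _ => ?_
  rw [weilConv_weilReflect_log_add_neg hψ.1 n]
  push_cast
  ring

/-- The same with the full series `Σ'_n` when `c(0) = 0` (only `log n < 2a` contributes: `k` vanishes at `|t| ≥ 2a`).
[cite: Bombieri2000Weil, Thm 2 (p. 193), prime term] -/
theorem setIntegral_setIntegral_kreinKernel_ramp_deriv_eq_tsum
    (hR : ∀ v, R v = ∑ n ∈ Finset.Icc 1 ⌊Real.exp |v|⌋₊, c n * (|v| - Real.log n)) (hc0 : c 0 = 0)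
    (ha : 0 < a) {ψ : ℝ → ℂ} (hψ : ψ ∈ screwTestC a) :
    ∫ t in Ioo (-a) a, ∫ u in Ioo (-a) a, kreinKernel R t u * deriv ψ u * conj (deriv ψ t) =
      ∑' n : ℕ, ((c n : ℝ) : ℂ) *
        (weilConv ψ (weilReflect ψ) (Real.log n) + weilConv ψ (weilReflect ψ) (-Real.log n)) := by
  set M : ℕ := ⌈Real.exp (2 * a)⌉₊ with hMdef
  have hM : Real.exp (2 * a) ≤ M := Nat.le_ceil _
  rw [setIntegral_setIntegral_kreinKernel_ramp_deriv hR ha hψ hM]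
  refine (tsum_eq_sum fun n hn => ?_).symm
  rw [Finset.mem_Icc, not_and_or, not_le, not_le] at hn
  rcases hn with hn | hn
  · have hn0 : n = 0 := by omega
    subst hn0
    simp [hc0]
  · have hnpos : (0 : ℝ) < n := by exact_mod_cast (show 0 < n by omega)
    have hlog : 2 * a ≤ Real.log n := by
      rw [Real.le_log_iff_exp_le hnpos]
      exact hM.trans (by exact_mod_cast hn.le)
    have h0 : 0 ≤ Real.log n := Real.log_natCast_nonneg n
    rw [weilConv_weilReflect_eq_zero_of_le_abs hψ.1 hψ.2 (by rwa [abs_of_nonneg h0]),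
      weilConv_weilReflect_eq_zero_of_le_abs hψ.1 hψ.2 (by rwa [abs_neg, abs_of_nonneg h0]),
      add_zero, mul_zero]

/-! ## §2 The `S`-truncated screw function `Ψ_S` and `Q_S(ψ) = ⟨ψ′, ψ′⟩_{G_S,a}` -/

variable {S : Finset ℕ} {ΨS : ℝ → ℝ}

/-- `Λ_S(0)/√0 = 0`. [folklore] -/
theorem weilSemilocalCoeff_zero (S : Finset ℕ) : weilSemilocalCoeff S 0 = 0 :=
  weilSemilocalCoeff_of_not_isPrimePow S not_isPrimePow_zero

/-- **The `S`-prime term through the ramp kernel**: for `0 < a`, `ψ ∈ C(a)`,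
`Σ_{primeFactors n ⊆ S} Λ(n) n^{-1/2}(k(log n) + k(−log n)) = ⟨ψ′,ψ′⟩_{K_{R_S},a}`, `k = ψ ⋆ ψ̃`,
`R_S(v) = Σ_{n ≤ e^{|v|}, primeFactors n ⊆ S} Λ(n) n^{-1/2}(|v| − log n)`. [cite: Connes1999, §VII Thm 4 (the S-local Weil sum)] -/
theorem weilSemilocalPrimeTerm_eq_kreinForm (ha : 0 < a) {ψ : ℝ → ℂ} (hψ : ψ ∈ screwTestC a) :
    weilSemilocalPrimeTerm S (weilConv ψ (weilReflect ψ)) =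
      ∫ t in Ioo (-a) a, ∫ u in Ioo (-a) a,
        kreinKernel (fun v => ∑ n ∈ Finset.Icc 1 ⌊Real.exp |v|⌋₊, weilSemilocalCoeff S n * (|v| - Real.log n))
          t u * deriv ψ u * conj (deriv ψ t) := by
  rw [setIntegral_setIntegral_kreinKernel_ramp_deriv_eq_tsum (c := weilSemilocalCoeff S) (fun v => rfl)
    (weilSemilocalCoeff_zero S) ha hψ]
  rfl

/-- `Ψ_S` is continuous. [folklore] -/
theorem continuous_semilocalScrew
    (hΨ : ∀ v, ΨS v = archScrew v -
      ∑ n ∈ Finset.Icc 1 ⌊Real.exp |v|⌋₊, weilSemilocalCoeff S n * (|v| - Real.log n)) :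
    Continuous ΨS := by
  have h : ΨS = fun v => archScrew v -
      ∑ n ∈ Finset.Icc 1 ⌊Real.exp |v|⌋₊, weilSemilocalCoeff S n * (|v| - Real.log n) := funext hΨ
  rw [h]
  exact continuous_archScrew.sub (continuous_ramp (c := weilSemilocalCoeff S) fun v => rfl)

/-- `Ψ_S` is even. [folklore] -/
theorem semilocalScrew_neg
    (hΨ : ∀ v, ΨS v = archScrew v -
      ∑ n ∈ Finset.Icc 1 ⌊Real.exp |v|⌋₊, weilSemilocalCoeff S n * (|v| - Real.log n)) (v : ℝ) :
    ΨS (-v) = ΨS v := by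
  rw [hΨ, hΨ, archScrew_neg, abs_neg]

/-- `Ψ_S(0) = 0`. [folklore] -/
theorem semilocalScrew_zero
    (hΨ : ∀ v, ΨS v = archScrew v -
      ∑ n ∈ Finset.Icc 1 ⌊Real.exp |v|⌋₊, weilSemilocalCoeff S n * (|v| - Real.log n)) :
    ΨS 0 = 0 := by
  rw [hΨ, archScrew_zero, ramp_zero (c := weilSemilocalCoeff S) (R := fun v =>
    ∑ n ∈ Finset.Icc 1 ⌊Real.exp |v|⌋₊, weilSemilocalCoeff S n * (|v| - Real.log n)) fun v => rfl]
  simp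

/-- `Q_S(g) = Q_∅(g) − Σ_{primeFactors n ⊆ S} Λ(n) n^{-1/2}(k(log n) + k(−log n))`, `k = g ⋆ g̃` (definitional:
`W_S = polar − P_S + arch`, `W_∅ = polar + arch`). [cite: Connes1999, §VII Thm 4 (semi-local functional)] -/
theorem weilSemilocalQuadratic_eq_empty_sub (S : Finset ℕ) (g : ℝ → ℂ) :
    weilSemilocalQuadratic S g =
      weilSemilocalQuadratic ∅ g - weilSemilocalPrimeTerm S (weilConv g (weilReflect g)) := by
  unfold weilSemilocalQuadratic weilSemilocalFunctional
  rw [weilSemilocalPrimeTerm_empty]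
  ring

/-- **`Q_S(ψ) = ⟨ψ′, ψ′⟩_{G_S,a}`** — RH-FREE identity for every finite `S`: for `0 < a` and `ψ ∈ C(a)`,
`W_S(ψ ⋆ ψ̃) = ∫_{(−a,a)}∫_{(−a,a)} (Ψ_S(t) + Ψ_S(u) − Ψ_S(t−u)) ψ′(u) conj ψ′(t) du dt` with the `S`-truncated screw
function `Ψ_S = Ψ_∅ − R_S`. (The `S = ∅` identity `weilSemilocalQuadratic_empty_eq_archForm` minus the ramp identity
for the `S`-prime term.) Nothing here bears on RH. [cite: Suzuki2023, Prop 3.1 and §4.3 (4.6)/(4.8)] -/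
theorem weilSemilocalQuadratic_eq_semilocalForm
    (hΨ : ∀ v, ΨS v = archScrew v -
      ∑ n ∈ Finset.Icc 1 ⌊Real.exp |v|⌋₊, weilSemilocalCoeff S n * (|v| - Real.log n))
    (ha : 0 < a) {ψ : ℝ → ℂ} (hψ : ψ ∈ screwTestC a) :
    weilSemilocalQuadratic S ψ =
      ∫ t in Ioo (-a) a, ∫ u in Ioo (-a) a, kreinKernel ΨS t u * deriv ψ u * conj (deriv ψ t) := by
  have hφ : deriv ψ ∈ screwTestC0 a := deriv_mem_screwTestC0 hψ
  have hfi : Integrable (deriv ψ) := hφ.1.1.continuous.integrable_of_hasCompactSupport hφ.1.2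
  have hf0 : ∀ t ∉ Ioo (-a) a, deriv ψ t = 0 := fun t ht => deriv_apply_eq_zero_of_not_mem hψ ht
  set RS : ℝ → ℝ := fun v =>
    ∑ n ∈ Finset.Icc 1 ⌊Real.exp |v|⌋₊, weilSemilocalCoeff S n * (|v| - Real.log n) with hRSdef
  have hRS : ∀ v, RS v = ∑ n ∈ Finset.Icc 1 ⌊Real.exp |v|⌋₊, weilSemilocalCoeff S n * (|v| - Real.log n) :=
    fun v => rfl
  have hRc : Continuous RS := continuous_ramp hRS
  rw [weilSemilocalQuadratic_eq_empty_sub, weilSemilocalQuadratic_empty_eq_archForm ha hψ,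
    weilSemilocalPrimeTerm_eq_kreinForm ha hψ, ← kreinKernel_archScrew,
    setIntegral_setIntegral_kreinKernel_eq_integral_prod continuous_archScrew hfi hf0,
    setIntegral_setIntegral_kreinKernel_eq_integral_prod hRc hfi hf0,
    setIntegral_setIntegral_kreinKernel_eq_integral_prod (continuous_semilocalScrew hΨ) hfi hf0]
  have i1 : Integrable (fun p : ℝ × ℝ =>
      kreinKernel archScrew p.1 p.2 * (deriv ψ p.2 * conj (deriv ψ p.1))) (volume.prod volume) := by
    simpa only [kreinKernel] using integrable_ofReal_mul_mul_conj_prod hfi hf0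
      (G := fun p : ℝ × ℝ => archScrew p.1 + archScrew p.2 - archScrew (p.1 - p.2)) continuous_archKernel_real
  have i2 : Integrable (fun p : ℝ × ℝ =>
      kreinKernel RS p.1 p.2 * (deriv ψ p.2 * conj (deriv ψ p.1))) (volume.prod volume) := by
    simpa only [kreinKernel] using integrable_ofReal_mul_mul_conj_prod hfi hf0
      (G := fun p : ℝ × ℝ => RS p.1 + RS p.2 - RS (p.1 - p.2)) (continuous_kreinKernel_real hRc)
  rw [← integral_sub i1 i2]
  refine integral_congr_ae (Eventually.of_forall fun p => ?_)
  simp only [kreinKernel, hΨ, hRS]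
  push_cast
  ring

/-! ## §3 The dictionary for every `S`: `T^S ≻ 0` on `(−a, a)` iff `Q_S ≥ 0` on `C(a)` -/

/-- **WEIL ⟹ DBR** for the `S`-truncated forms: semi-local positivity on `C(a)` gives positive semidefiniteness of
`G_S = Ψ_S(t) + Ψ_S(u) − Ψ_S(t−u)` on finite configurations in `(−a, a)`. [cite: Suzuki2023, (1.5) and Prop 3.1] -/
theorem isPosSemidefKernelOn_semilocalKernel_of_weilSemilocalPositivityOn
    (hΨ : ∀ v, ΨS v = archScrew v -
      ∑ n ∈ Finset.Icc 1 ⌊Real.exp |v|⌋₊, weilSemilocalCoeff S n * (|v| - Real.log n))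
    (hW : WeilSemilocalPositivityOn S a) :
    IsPosSemidefKernelOn (kreinKernel ΨS) (Ioo (-a) a) := by
  by_cases ha : 0 < a
  swap
  · intro N t ht cc
    rcases Nat.eq_zero_or_pos N with hN | hN
    · subst hN; simp
    · exact absurd (ht ⟨0, hN⟩) fun h => ha (by linarith [h.1, h.2])
  refine krein_psd_Ioo_of_forall_re_nonneg (continuous_semilocalScrew hΨ) (semilocalScrew_neg hΨ)
    (semilocalScrew_zero hΨ) fun φ hφ => ?_
  have hψ : screwPrimitive a 0 φ ∈ screwTestC a := screwPrimitive_mem_screwTestC hφ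
  have h : 0 ≤ (weilSemilocalQuadratic S (screwPrimitive a 0 φ)).re := hW _ hψ.1 hψ.2
  rwa [weilSemilocalQuadratic_eq_semilocalForm hΨ ha hψ, deriv_screwPrimitive_of_mem hφ] at h

/-- **DBR ⟹ WEIL on the compact window** for the `S`-truncated forms. [cite: Suzuki2023, Prop 3.1 and (1.4)] -/
theorem weilSemilocalPositivityOn_of_isPosSemidefKernelOn_semilocalKernel_Icc
    (hΨ : ∀ v, ΨS v = archScrew v -
      ∑ n ∈ Finset.Icc 1 ⌊Real.exp |v|⌋₊, weilSemilocalCoeff S n * (|v| - Real.log n))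
    (ha : 0 < a) (h : IsPosSemidefKernelOn (kreinKernel ΨS) (Icc (-a) a)) : WeilSemilocalPositivityOn S a := by
  intro g hg hsupp
  have hψ : g ∈ screwTestC a := ⟨hg, hsupp⟩
  have hφc : Continuous (deriv g) := hg.1.continuous_deriv (by simp)
  rw [weilSemilocalQuadratic_eq_semilocalForm hΨ ha hψ]
  have hpsd : ∀ (N : ℕ) (t : Fin N → ℝ) (x : Fin N → ℝ), (∀ i, t i ∈ Icc (-a) a) →
      0 ≤ ∑ i, ∑ j, x i * x j * (ΨS (t i) + ΨS (t j) - ΨS (t i - t j)) := by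
    intro N t x ht
    rw [krein_psd_iff_real (semilocalScrew_neg hΨ)] at h
    refine (h N t x ht).trans_eq (Finset.sum_congr rfl fun i _ => Finset.sum_congr rfl fun j _ => ?_)
    ring
  have hKs : ∀ t u : ℝ, ΨS t + ΨS u - ΨS (t - u) = ΨS u + ΨS t - ΨS (u - t) := by
    intro t u; rw [← semilocalScrew_neg hΨ (t - u), neg_sub]; ring
  have hK : ∀ t u, kreinKernel ΨS t u = ((ΨS t + ΨS u - ΨS (t - u) : ℝ) : ℂ) := fun t u => rfl
  simp only [hK]
  exact re_setIntegral_setIntegral_nonneg_of_psd (K := fun t u => ΨS t + ΨS u - ΨS (t - u))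
    (continuous_kreinKernel_real (continuous_semilocalScrew hΨ)) hKs hpsd hφc

/-- **DBR ⟹ WEIL** for the `S`-truncated forms (open window; closedness of the semi-locally positive windows,
Column WEIL's `weilSemilocalPositivityOn_of_forall_lt`). [cite: Yoshida1992HermitianForms, Prop. 6 (p. 320) with Lemma 7 (p. 312)] -/
theorem weilSemilocalPositivityOn_of_isPosSemidefKernelOn_semilocalKernel
    (hΨ : ∀ v, ΨS v = archScrew v -
      ∑ n ∈ Finset.Icc 1 ⌊Real.exp |v|⌋₊, weilSemilocalCoeff S n * (|v| - Real.log n))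
    (h : IsPosSemidefKernelOn (kreinKernel ΨS) (Ioo (-a) a)) : WeilSemilocalPositivityOn S a := by
  by_cases ha : 0 < a
  · refine weilSemilocalPositivityOn_of_forall_lt ha fun b hb hba => ?_
    exact weilSemilocalPositivityOn_of_isPosSemidefKernelOn_semilocalKernel_Icc hΨ hb
      (h.mono (Icc_subset_Ioo (by linarith) hba))
  · exact (weilSemilocalPositivityOn_log_two_half S).mono
      ((not_lt.1 ha).trans (div_nonneg (Real.log_nonneg one_le_two) zero_le_two))

/-- **THE WEIL ↔ DBR DICTIONARY, every row.** For every finite `S` and real `a`: the Kreĭn kernel of the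
`S`-truncated screw function `Ψ_S` is positive semidefinite on finite configurations in `(−a, a)` iff the semi-local
Weil form at `S ∪ {∞}` is non-negative on `C(a)`. RH-FREE glue; nothing here bears on RH. [cite: Suzuki2023, (1.5) and Prop 3.1] -/
theorem isPosSemidefKernelOn_semilocalKernel_iff
    (hΨ : ∀ v, ΨS v = archScrew v -
      ∑ n ∈ Finset.Icc 1 ⌊Real.exp |v|⌋₊, weilSemilocalCoeff S n * (|v| - Real.log n)) (a : ℝ) :
    IsPosSemidefKernelOn (kreinKernel ΨS) (Ioo (-a) a) ↔ WeilSemilocalPositivityOn S a :=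
  ⟨weilSemilocalPositivityOn_of_isPosSemidefKernelOn_semilocalKernel hΨ,
    isPosSemidefKernelOn_semilocalKernel_of_weilSemilocalPositivityOn hΨ⟩

/-- One-sided window form (ENGINE-TARGETS §3.1 «ℓ = 2a»): `T^S_ℓ ≻ 0` on configurations in `(0, ℓ)` iff `Q_S ≥ 0`
on `C(ℓ/2)`. [cite: Suzuki2023, (1.5)] -/
theorem isPosSemidefKernelOn_semilocalKernel_Ioo_zero_iff
    (hΨ : ∀ v, ΨS v = archScrew v -
      ∑ n ∈ Finset.Icc 1 ⌊Real.exp |v|⌋₊, weilSemilocalCoeff S n * (|v| - Real.log n)) (l : ℝ) :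
    IsPosSemidefKernelOn (kreinKernel ΨS) (Ioo 0 l) ↔ WeilSemilocalPositivityOn S (l / 2) := by
  rw [← isPosSemidefKernelOn_semilocalKernel_iff hΨ, krein_psd_symm_iff (semilocalScrew_neg hΨ)
    (semilocalScrew_zero hΨ), show 2 * (l / 2) = l by ring]

/-- **`ℓ*(S) = 2·a*(S)`**: the `S`-truncated kernel holds on `(0, ℓ)` iff `ℓ ≤ 2·weilSemilocalThreshold S`.
[cite: Yoshida1992HermitianForms, Prop. 6 (p. 320), with the primes restricted to S] -/
theorem isPosSemidefKernelOn_semilocalKernel_Ioo_zero_iff_le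
    (hΨ : ∀ v, ΨS v = archScrew v -
      ∑ n ∈ Finset.Icc 1 ⌊Real.exp |v|⌋₊, weilSemilocalCoeff S n * (|v| - Real.log n)) (l : ℝ) :
    IsPosSemidefKernelOn (kreinKernel ΨS) (Ioo 0 l) ↔ l ≤ 2 * weilSemilocalThreshold S := by
  rw [isPosSemidefKernelOn_semilocalKernel_Ioo_zero_iff hΨ, weilSemilocalPositivityOn_iff_le_weilSemilocalThreshold]
  constructor <;> intro h <;> linarith

/-- **The DBR «necessity depth» statement IS Column WEIL's wall offset**: for every `q`,
`0 ≤ wallOffset q ↔` the Kreĭn kernel of `Ψ_{primes < q}` is PSD on finite configurations in `(0, log q)` — i.e.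
ET6's «δ(q) ≥ 0» (window `ℓ = log q`, primes `< q` kept). RH-FREE per `q`. [cite: Yoshida1992HermitianForms, Prop. 6 (p. 320), with the primes restricted to S] -/
theorem wallOffset_nonneg_iff_semilocalKernel {q : ℕ} {Ψq : ℝ → ℝ}
    (hΨ : ∀ v, Ψq v = archScrew v -
      ∑ n ∈ Finset.Icc 1 ⌊Real.exp |v|⌋₊, weilSemilocalCoeff (Nat.primesBelow q) n * (|v| - Real.log n)) :
    0 ≤ wallOffset q ↔ IsPosSemidefKernelOn (kreinKernel Ψq) (Ioo 0 (Real.log q)) := by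
  rw [wallOffset_nonneg_iff, isPosSemidefKernelOn_semilocalKernel_Ioo_zero_iff hΨ]

/-- RH-EQUIVALENT (labelled; NOT claimed): the `∀`-form of the DBR necessity-depth statement — «for every prime `q`
the Kreĭn kernel of the truncated screw function `Ψ_{primes < q}` is PSD on `(0, log q)`» — IS the Riemann Hypothesis,
through Column WEIL's `riemannHypothesis_iff_forall_wallOffset_nonneg`. [cite: Yoshida1992HermitianForms, Prop. 6 (p. 320) and Thm 2] -/
theorem riemannHypothesis_iff_forall_semilocalKernel :
    Summit.RiemannHypothesis ↔ ∀ q : ℕ, q.Prime →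
      IsPosSemidefKernelOn (kreinKernel fun v => archScrew v -
        ∑ n ∈ Finset.Icc 1 ⌊Real.exp |v|⌋₊, weilSemilocalCoeff (Nat.primesBelow q) n * (|v| - Real.log n))
        (Ioo 0 (Real.log q)) := by
  rw [riemannHypothesis_iff_forall_wallOffset_nonneg]
  refine forall_congr' fun q => imp_congr_right fun _ => ?_
  exact wallOffset_nonneg_iff_semilocalKernel fun v => rfl

end Summit.RiemannHypothesis.RiemannHypothesis.Theorems.ZetaStringArchWall

end
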